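import Literature.AlgebraicGeometry.Frobenioids.EndomorphismsNonExpanding
import Literature.AlgebraicGeometry.Frobenioids.EndomorphismsAutFixesDivWitness
import Literature.AlgebraicGeometry.Frobenioids.FinSubextCatAut
import Literature.AlgebraicGeometry.Frobenioids.ArithmeticFrobenioidStandard
import Literature.AlgebraicGeometry.Frobenioids.ArithmeticFrobenioidDivSlim
import Literature.AlgebraicGeometry.Frobenioids.ArchimedeanPointBase
import Mathlib.GroupTheory.OrderOfElement
import HarnessLib

/-!
# Frobenioids I, Proposition 1.12 (ii)/(iv) and the hypothesis (H) `AutFixesDiv`: universal closures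
# REFUTED, instance forms PROVED

Mochizuki, *The geometry of Frobenioids I: the general theory*, Kyushu J. Math. **62** (2008)
293–400, §1, Proposition 1.12 (ii), (iv), kurims text p. 39 [cite: MochizukiFrdI2008, Prop. 1.12(ii) p.39].

PROOF-ONLY companion (abc-iut cell, F fact-proving wave, seat abc-iut-f-039; FACT-LIST rows
F-1076 `PreFrobenioid.AutFixesDiv`, F-1077 `PreFrobenioid.AutSaturatedIffStatement`,
F-1078 `PreFrobenioid.EndoIsSubAutomorphismIffStatement`, all declared in `Endomorphisms.lean`; nothing
there is edited or restated). The three rows are SCHEMATA over the binders `(D, Φ, C, F[, A])`: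

* **Universal closures refuted** (`PreFrobenioid.not_forall_autFixesDiv`,
  `PreFrobenioid.not_forall_autSaturatedIffStatement`,
  `PreFrobenioid.not_forall_endoIsSubAutomorphismIffStatement`): by abc-iut-L1-t1's kernel-checked
  elementary Frobenioid `F_Φ → F_{Φ^char}` over `B(ℤ)` with `Φ(pt) = ℚ_{≥0}`, generator acting by `2`
  (`EndomorphismsCounterexample.lean`, `EndomorphismsAutFixesDivWitness.lean`) — even among Frobenioids
  in the sense of [FrdI] Def. 1.3.
* **Instance forms proved.** (1) If every automorphism group `Aut_D(A)` of the base category is finite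
  (more generally torsion), the elementwise hypothesis (H) `IsAutNonExpandingOn Φ` of
  `EndomorphismsNonExpanding.lean` holds for every divisorial `Φ` (`isAutNonExpandingOn_of_finite_aut`:
  `(b^*)^{ord b} = id`), hence Prop. 1.12 (ii) and (iv) AS PRINTED hold for every Frobenioid over such a
  base (`PreFrobenioid.endoIsSubAutomorphismIffStatement_of_finite_aut`,
  `PreFrobenioid.autSaturatedIffStatement_of_finite_aut`); in particular over the base
  `D = B(Gal(K/F))⁰ = FinSubextCat F K` of [FrdI] Ex. 6.1/6.3 (`Aut_D(Spec L) ↪ Hom_F(L, L)` is finite,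
  abc-iut-L6-t10's `FinSubextCat.finite_aut`), so for THE arithmetic Frobenioid `C_{K/F}` of
  [FrdI] Ex. 6.3 / Thm. 6.4 (`PreFrobenioid.endoIsSubAutomorphismIffStatement_arith`,
  `PreFrobenioid.autSaturatedIffStatement_arith`). (2) (H) `AutFixesDiv F` ("automorphisms act
  trivially on zero divisors") holds whenever the base category has only trivial endomorphisms
  (`PreFrobenioid.autFixesDiv_of_subsingleton_endo`), e.g. for [FrdII] Ex. 3.3's archimedean Frobenioid
  `C_v` over the one-morphism base at `Spec ℂ` (abc-iut-L1-t6's `ArchFrd.Cpt`):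
  `PreFrobenioid.autFixesDiv_Cpt`, whence Prop. 1.12 (ii)/(iv) there with NO hypothesis
  (`PreFrobenioid.endoIsSubAutomorphismIffStatement_Cpt`, `PreFrobenioid.autSaturatedIffStatement_Cpt`).

* **(H) `AutFixesDiv` FAILS at [FrdI] Ex. 6.3** (`PreFrobenioid.not_autFixesDiv_arith`): for `C_{K/F}`, as
  soon as some `Spec L ∈ D` has a nontrivial `F`-automorphism `ρ` — `ρ` moves a prime `v` of `L` (FrdI p. 115,
  "any automorphism of a number field that fixes all of the valuations … is the identity"; abc-iut-L6-t10's
  `NumberFields.exists_map_heightOneSpectrum_ne`), so the automorphism `(1, ρ, 0, 1)` of the object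
  `(Spec L, 0)` does not fix the zero divisor `[v]` of `(1, id, [v], 1) : (Spec L, 0) → (Spec L, [v])`. So (H) as
  typed excludes the motivating arithmetic Frobenioids, while Prop. 1.12 (ii)/(iv) hold there (above).

`AutFixesDiv` is abc-iut-L1-t1's EXPLICIT extra hypothesis (the equality the printed proof uses), not a
statement of the paper; this file asserts nothing about the author's intention. Prop. 1.12 is not cited by
[IUTchI–IV] or [EtTh] (cell census); nothing here bears on [IUTchIII] Cor. 3.12. No new definition, no
named fact, no `sorry`.
-/

namespace Literature.AlgebraicGeometry.Frobenioids

open CategoryTheory Opposite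

universe w v v' u u'

/-! ### Finite (torsion) automorphism groups of the base give the non-expanding hypothesis (H) -/

section FiniteAut

variable {D : Type u} [Category.{v} D]

/-- Pulling back along the `n`-th power of an automorphism `b ∈ Aut_D(A)` (group law of `Aut`) is the
`n`-th iterate of `b^*`. [cite: MochizukiFrdI2008, Def. 1.1(ii)] -/
theorem pull_aut_pow_apply (Φ : Dᵒᵖ ⥤ CommMonCat.{w}) {A : D} (b : Aut A) (n : ℕ) (x : Φ.obj (op A)) :
    pull Φ (b ^ n).hom x = (pull Φ b.hom)^[n] x := by
  induction n with
  | zero =>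
    rw [pow_zero, Function.iterate_zero, id_eq]
    exact pull_id Φ A x
  | succ n ih =>
    rw [pow_succ, Aut.Aut_mul_def, Iso.trans_hom, pull_comp, ih, Function.iterate_succ_apply']

/-- **(H) from finiteness of the automorphism groups of the base.** If `Φ` is (objectwise) divisorial
and every `Aut_D(A)` is finite, then base automorphisms never strictly enlarge a divisor
(`IsAutNonExpandingOn Φ`): `b^{ord b} = 1` gives `(b^*)^{ord b} = id`, and
`isAutNonExpandingOn_of_finite_order` applies. Covers every base whose automorphism groups are finite,
e.g. the connected objects of a Galois category. [cite: MochizukiFrdI2008, Prop. 1.12(ii) p.39] -/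
theorem isAutNonExpandingOn_of_finite_aut {Φ : Dᵒᵖ ⥤ CommMonCat.{w}}
    (hdiv : ∀ A : D, IsDivisorial (Φ.obj (op A))) (hfin : ∀ A : D, Finite (Aut A)) :
    IsAutNonExpandingOn Φ := by
  refine isAutNonExpandingOn_of_finite_order hdiv fun A b => ?_
  haveI := hfin A
  refine ⟨@orderOf (Aut A) _ b, @orderOf_pos (Aut A) _ _ b, fun x => ?_⟩
  rw [← pull_aut_pow_apply Φ b (@orderOf (Aut A) _ b), @pow_orderOf_eq_one (Aut A) _ b]
  exact pull_id Φ A x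

namespace PreFrobenioid

variable {Φ : Dᵒᵖ ⥤ CommMonCat.{w}} {C : Type u'} [Category.{v'} C] {F : C ⥤ ElemFrobenioid Φ}

/-- Over a pre-Frobenioid the divisor monoid is divisorial, so (H) `IsAutNonExpandingOn Φ` follows from
finiteness of the base automorphism groups alone. [cite: MochizukiFrdI2008, Prop. 1.12(ii) p.39] -/
theorem isAutNonExpandingOn_of_isPreFrobenioid_of_finite_aut (hP : IsPreFrobenioid Φ F)
    (hfin : ∀ A : D, Finite (Aut A)) : IsAutNonExpandingOn Φ :=
  isAutNonExpandingOn_of_finite_aut (fun A => hP.isDivisorial A) hfin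

/-- **Prop. 1.12 (ii), printed necessity ("a sub-automorphism is isometric"), instance form**: holds for
every pre-Frobenioid over a base with finite automorphism groups.
[cite: MochizukiFrdI2008, Prop. 1.12(ii) p.39] -/
theorem subAutomorphismIsIsometryStatement_of_finite_aut (hP : IsPreFrobenioid Φ F)
    (hfin : ∀ A : D, Finite (Aut A)) (A : C) : SubAutomorphismIsIsometryStatement F A :=
  subAutomorphismIsIsometryStatement_of_isAutNonExpandingOn hP
    (isAutNonExpandingOn_of_isPreFrobenioid_of_finite_aut hP hfin) A

/-- **Prop. 1.12 (ii) as printed, instance form (FACT-LIST F-1078)**: "an endomorphism of `A` is a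
sub-automorphism iff it is an isometric linear endomorphism that projects to a sub-automorphism of `D`"
holds for every Frobenioid over a base with finite automorphism groups.
[cite: MochizukiFrdI2008, Prop. 1.12(ii) p.39] -/
theorem endoIsSubAutomorphismIffStatement_of_finite_aut (hF : IsFrobenioid F)
    (hfin : ∀ A : D, Finite (Aut A)) (A : C) : EndoIsSubAutomorphismIffStatement F A :=
  endoIsSubAutomorphismIffStatement_of_isAutNonExpandingOn hF
    (isAutNonExpandingOn_of_isPreFrobenioid_of_finite_aut hF.isPreFrobenioid hfin) A

/-- **Prop. 1.12 (iv) as printed, instance form (FACT-LIST F-1077)**: "suppose `A` is `Aut^sub`-ample;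
then `A` is `Aut`-saturated iff `A_D` is" holds for every Frobenioid over a base with finite automorphism
groups. [cite: MochizukiFrdI2008, Prop. 1.12(iv) p.39] -/
theorem autSaturatedIffStatement_of_finite_aut (hF : IsFrobenioid F)
    (hfin : ∀ A : D, Finite (Aut A)) (A : C) : AutSaturatedIffStatement F A :=
  autSaturatedIffStatement_of_isAutNonExpandingOn hF
    (isAutNonExpandingOn_of_isPreFrobenioid_of_finite_aut hF.isPreFrobenioid hfin) A

/-! ### (H) `AutFixesDiv` over bases with trivial endomorphisms -/

variable (F) in
/-- **(H) `AutFixesDiv`, instance form (FACT-LIST F-1076)**: if every object of the base category has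
only the identity as endomorphism (e.g. a one-morphism base), then `Base(β)^* Div(φ) = Div(φ)` for every
automorphism `β` and arrow `φ` — automorphisms act trivially on zero divisors.
[cite: MochizukiFrdI2008, Prop. 1.12(ii) p.39] -/
theorem autFixesDiv_of_subsingleton_endo (h : ∀ X : D, Subsingleton (X ⟶ X)) : AutFixesDiv F := by
  intro B A β φ
  haveI := h (baseObj F B)
  rw [Subsingleton.elim (Base F β.hom) (𝟙 (baseObj F B)), pull_id]

end PreFrobenioid

end FiniteAut

/-! ### The universal closures are refuted (the rows are schemata, not facts) -/

namespace PreFrobenioid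

/-- **F-1076: the universal closure of `AutFixesDiv` is FALSE** — it fails for abc-iut-L1-t1's
elementary Frobenioid `F_Φ → F_{Φ^char}` over `B(ℤ)` (`Φ(pt) = ℚ_{≥0}`, generator acting by `2`;
`EndomorphismsCounterexample.not_autFixesDiv`). [cite: MochizukiFrdI2008, Prop. 1.12(ii) p.39] -/
theorem not_forall_autFixesDiv :
    ¬ ∀ (D : Type) [Category.{0} D] (Φ : Dᵒᵖ ⥤ CommMonCat.{0}) (C : Type) [Category.{0} C]
        (F : C ⥤ ElemFrobenioid Φ), AutFixesDiv F :=
  fun h => EndomorphismsCounterexample.not_autFixesDiv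
    (h _ _ _ (ElemFrobenioid.toChar EndomorphismsCounterexample.Φex))

/-- F-1076, sharper: `AutFixesDiv` fails even among FROBENIOIDS ([FrdI] Def. 1.3).
[cite: MochizukiFrdI2008, Prop. 1.12(ii) p.39] -/
theorem not_forall_isFrobenioid_autFixesDiv :
    ¬ ∀ (D : Type) [Category.{0} D] (Φ : Dᵒᵖ ⥤ CommMonCat.{0}) (C : Type) [Category.{0} C]
        (F : C ⥤ ElemFrobenioid Φ), IsFrobenioid F → AutFixesDiv F :=
  fun h => EndomorphismsCounterexample.not_autFixesDiv
    (h _ _ _ (ElemFrobenioid.toChar EndomorphismsCounterexample.Φex) EndomorphismsCounterexample.isFrobenioid)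

/-- **F-1078: the universal closure of `EndoIsSubAutomorphismIffStatement` is FALSE** (same Frobenioid,
object `A`: the sub-automorphism `α = (b, 1, 1)` is not isometric;
`EndomorphismsCounterexample.not_endoIsSubAutomorphismIffStatement`).
[cite: MochizukiFrdI2008, Prop. 1.12(ii) p.39] -/
theorem not_forall_endoIsSubAutomorphismIffStatement :
    ¬ ∀ (D : Type) [Category.{0} D] (Φ : Dᵒᵖ ⥤ CommMonCat.{0}) (C : Type) [Category.{0} C]
        (F : C ⥤ ElemFrobenioid Φ) (A : C), EndoIsSubAutomorphismIffStatement F A :=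
  fun h => EndomorphismsCounterexample.not_endoIsSubAutomorphismIffStatement
    (h _ _ _ (ElemFrobenioid.toChar EndomorphismsCounterexample.Φex) EndomorphismsCounterexample.A)

/-- F-1078, sharper: Prop. 1.12 (ii) as printed fails even among FROBENIOIDS ([FrdI] Def. 1.3).
[cite: MochizukiFrdI2008, Prop. 1.12(ii) p.39] -/
theorem not_forall_isFrobenioid_endoIsSubAutomorphismIffStatement :
    ¬ ∀ (D : Type) [Category.{0} D] (Φ : Dᵒᵖ ⥤ CommMonCat.{0}) (C : Type) [Category.{0} C]
        (F : C ⥤ ElemFrobenioid Φ), IsFrobenioid F → ∀ A : C, EndoIsSubAutomorphismIffStatement F A :=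
  fun h => EndomorphismsCounterexample.not_endoIsSubAutomorphismIffStatement
    (h _ _ _ (ElemFrobenioid.toChar EndomorphismsCounterexample.Φex)
      EndomorphismsCounterexample.isFrobenioid EndomorphismsCounterexample.A)

/-- **F-1077: the universal closure of `AutSaturatedIffStatement` is FALSE** (same Frobenioid: `A` is
`Aut^sub`-ample over an `Aut`-saturated base but not `Aut`-saturated;
`EndomorphismsCounterexample.not_autSaturatedIffStatement`). [cite: MochizukiFrdI2008, Prop. 1.12(iv) p.39] -/
theorem not_forall_autSaturatedIffStatement :
    ¬ ∀ (D : Type) [Category.{0} D] (Φ : Dᵒᵖ ⥤ CommMonCat.{0}) (C : Type) [Category.{0} C]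
        (F : C ⥤ ElemFrobenioid Φ) (A : C), AutSaturatedIffStatement F A :=
  fun h => EndomorphismsCounterexample.not_autSaturatedIffStatement
    (h _ _ _ (ElemFrobenioid.toChar EndomorphismsCounterexample.Φex) EndomorphismsCounterexample.A)

/-- F-1077, sharper: Prop. 1.12 (iv) as printed fails even among FROBENIOIDS ([FrdI] Def. 1.3).
[cite: MochizukiFrdI2008, Prop. 1.12(iv) p.39] -/
theorem not_forall_isFrobenioid_autSaturatedIffStatement :
    ¬ ∀ (D : Type) [Category.{0} D] (Φ : Dᵒᵖ ⥤ CommMonCat.{0}) (C : Type) [Category.{0} C]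
        (F : C ⥤ ElemFrobenioid Φ), IsFrobenioid F → ∀ A : C, AutSaturatedIffStatement F A :=
  fun h => EndomorphismsCounterexample.not_autSaturatedIffStatement
    (h _ _ _ (ElemFrobenioid.toChar EndomorphismsCounterexample.Φex)
      EndomorphismsCounterexample.isFrobenioid EndomorphismsCounterexample.A)

end PreFrobenioid

/-! ### The named instances: [FrdI] Ex. 6.1/6.3 bases `FinSubextCat F K`, the arithmetic Frobenioid
`C_{K/F}`, and [FrdII] Ex. 3.3's `C_v` over the one-morphism base -/

noncomputable section

namespace PreFrobenioid

section FinSubext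

variable {F₀ : Type u} [Field F₀] {K : Type u} [Field K] [Algebra F₀ K]
  {Φ : (FinSubextCat F₀ K)ᵒᵖ ⥤ CommMonCat.{w}} {C : Type u'} [Category.{v'} C]
  {F : C ⥤ ElemFrobenioid Φ}

/-- Over the base `D = B(Gal(K/F))⁰ = FinSubextCat F K` of [FrdI] Ex. 6.1/6.3 every pre-Frobenioid
satisfies (H) `IsAutNonExpandingOn`: `Aut_D(Spec L)` is finite (`FinSubextCat.finite_aut`).
[cite: MochizukiFrdI2008, Ex. 6.3 p.113] -/
theorem isAutNonExpandingOn_finSubextCat (hP : IsPreFrobenioid Φ F) : IsAutNonExpandingOn Φ :=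
  isAutNonExpandingOn_of_isPreFrobenioid_of_finite_aut hP fun X => FinSubextCat.finite_aut X

/-- **Prop. 1.12 (ii) as printed holds for every Frobenioid over `FinSubextCat F K`** (the bases of
[FrdI] Ex. 6.1 and Ex. 6.3). [cite: MochizukiFrdI2008, Prop. 1.12(ii) p.39] -/
theorem endoIsSubAutomorphismIffStatement_finSubextCat (hF : IsFrobenioid F) (A : C) :
    EndoIsSubAutomorphismIffStatement F A :=
  endoIsSubAutomorphismIffStatement_of_finite_aut hF (fun X => FinSubextCat.finite_aut X) A

/-- **Prop. 1.12 (iv) as printed holds for every Frobenioid over `FinSubextCat F K`** (the bases of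
[FrdI] Ex. 6.1 and Ex. 6.3). [cite: MochizukiFrdI2008, Prop. 1.12(iv) p.39] -/
theorem autSaturatedIffStatement_finSubextCat (hF : IsFrobenioid F) (A : C) :
    AutSaturatedIffStatement F A :=
  autSaturatedIffStatement_of_finite_aut hF (fun X => FinSubextCat.finite_aut X) A

end FinSubext

section Arith

variable (F₀ : Type) [Field F₀] [NumberField F₀] (K : Type) [Field K] [Algebra F₀ K] [IsGalois F₀ K]

/-- **Prop. 1.12 (ii) as printed (FACT-LIST F-1078) holds for THE arithmetic Frobenioid `C_{K/F}` of
[FrdI] Ex. 6.3 / Thm. 6.4** (abc-iut-L6-t10's `arithFrobenioid F K`, a Frobenioid by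
`arithFrobenioid_isFrobenioid`), for every object `A`. [cite: MochizukiFrdI2008, Prop. 1.12(ii) p.39] -/
theorem endoIsSubAutomorphismIffStatement_arith (A : arithFrobenioid F₀ K) :
    EndoIsSubAutomorphismIffStatement
      (ModelFrobenioid.toElem (arithDivisorFunctor F₀ K) (unitsFunctor F₀ K) (divNatTrans F₀ K)) A :=
  endoIsSubAutomorphismIffStatement_finSubextCat (arithFrobenioid_isFrobenioid F₀ K) A

/-- **Prop. 1.12 (iv) as printed (FACT-LIST F-1077) holds for THE arithmetic Frobenioid `C_{K/F}` of
[FrdI] Ex. 6.3 / Thm. 6.4**, for every object `A`. [cite: MochizukiFrdI2008, Prop. 1.12(iv) p.39] -/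
theorem autSaturatedIffStatement_arith (A : arithFrobenioid F₀ K) :
    AutSaturatedIffStatement
      (ModelFrobenioid.toElem (arithDivisorFunctor F₀ K) (unitsFunctor F₀ K) (divNatTrans F₀ K)) A :=
  autSaturatedIffStatement_finSubextCat (arithFrobenioid_isFrobenioid F₀ K) A

end Arith

section Cpt

/-- **(H) `AutFixesDiv` (FACT-LIST F-1076) holds for [FrdII] Ex. 3.3's archimedean Frobenioid `C_v`
over the one-morphism base at `Spec ℂ`** (abc-iut-L1-t6's `ArchFrd.C.toElem ArchFrd.ptBase`, base
category `Discrete PUnit`: its only endomorphism is the identity). CLOSED instance, no hypothesis.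
[cite: MochizukiFrdII2008, Ex 3.3 (ii) p.28] -/
theorem autFixesDiv_Cpt : AutFixesDiv (ArchFrd.C.toElem ArchFrd.ptBase) :=
  autFixesDiv_of_subsingleton_endo _ fun _ => inferInstance

/-- **Prop. 1.12 (ii) as printed (FACT-LIST F-1078) holds for [FrdII] Ex. 3.3's `C_v` over the
one-morphism base at `Spec ℂ`**, for every object, with NO hypothesis (the Frobenioid property is
abc-iut-L1-t6's `ArchFrd.Cpt.isFrobenioid`). [cite: MochizukiFrdI2008, Prop. 1.12(ii) p.39] -/
theorem endoIsSubAutomorphismIffStatement_Cpt (A : ArchFrd.Cpt) :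
    EndoIsSubAutomorphismIffStatement (ArchFrd.C.toElem ArchFrd.ptBase) A :=
  endoIsSubAutomorphismIffStatement_of_autFixesDiv ArchFrd.Cpt.isFrobenioid autFixesDiv_Cpt A

/-- **Prop. 1.12 (iv) as printed (FACT-LIST F-1077) holds for [FrdII] Ex. 3.3's `C_v` over the
one-morphism base at `Spec ℂ`**, for every object, with NO hypothesis.
[cite: MochizukiFrdI2008, Prop. 1.12(iv) p.39] -/
theorem autSaturatedIffStatement_Cpt (A : ArchFrd.Cpt) :
    AutSaturatedIffStatement (ArchFrd.C.toElem ArchFrd.ptBase) A :=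
  autSaturatedIffStatement_of_autFixesDiv ArchFrd.Cpt.isFrobenioid autFixesDiv_Cpt A

end Cpt

section ArithNeg

variable (F₀ : Type) [Field F₀] [NumberField F₀] (K : Type) [Field K] [Algebra F₀ K]

/-- **(H) `AutFixesDiv` (FACT-LIST F-1076) FAILS for THE arithmetic Frobenioid `C_{K/F}` of [FrdI] Ex. 6.3 /
Thm. 6.4** as soon as some `Spec L ∈ D = B(Gal(K/F))⁰` carries a nontrivial `F`-automorphism `ρ`: by "any
automorphism of a number field that fixes all of the valuations of the number field is clearly equal to the
identity automorphism" (FrdI p. 115; kernel: `NumberFields.exists_map_heightOneSpectrum_ne`) `ρ` moves a prime `v`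
of `L`; then for the automorphism `β = (1, ρ, 0, 1)` of the object `(Spec L, 0)` of `C_{K/F}` and the morphism
`φ = (1, id, [v], 1) : (Spec L, 0) → (Spec L, [v])` one has `Base(β)^* Div(φ) = ρ^*[v] ≠ [v] = Div(φ)`. So
abc-iut-L1-t1's (H) EXCLUDES the motivating Example 6.3 (whereas Prop. 1.12 (ii)/(iv) hold there,
`endoIsSubAutomorphismIffStatement_arith` / `autSaturatedIffStatement_arith`, via the weaker non-expanding
hypothesis). No Galois hypothesis on `K/F` is needed. [cite: MochizukiFrdI2008, Thm. 6.4 (i) p.115] -/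
theorem not_autFixesDiv_arith (X : FinSubextCat F₀ K) (ρ : X.L ≃ₐ[F₀] X.L) (hρ : ρ ≠ AlgEquiv.refl) :
    ¬ AutFixesDiv
      (ModelFrobenioid.toElem (arithDivisorFunctor F₀ K) (unitsFunctor F₀ K) (divNatTrans F₀ K)) := by
  intro hH
  -- a prime `v` of `L` moved by `ρ`
  have hρ' : (ρ : X.L ≃+* X.L) ≠ RingEquiv.refl X.L := fun h =>
    hρ (AlgEquiv.ext fun a => RingEquiv.congr_fun h a)
  obtain ⟨v, hv⟩ :=
    Literature.NumberTheory.NumberFields.exists_map_heightOneSpectrum_ne (ρ : X.L ≃+* X.L) hρ'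
  have hne : ArithPullback.underPlace ((ρ : X.L ≃+* X.L) : X.L →+* X.L) (NumberField.FinitePlace.mk v) ≠
      NumberField.FinitePlace.mk v :=
    ArithPullback.underPlace_ne_self_of_map_ne (ρ : X.L ≃+* X.L) v hv
  -- the base automorphism `Spec ρ` of `Spec L` in `D` and the prime divisor `[v] ∈ Φ(L)`
  let b : X ≅ X := FinSubextCat.isoOfAlgEquiv X ρ
  let x : (arithDivisorFunctor F₀ K).obj (op X) :=
    Multiplicative.ofAdd ((Finsupp.single (NumberField.FinitePlace.mk v) 1, 0) : EffArithDivisor X.L)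
  -- relation (d) of Thm. 5.2 (i) for the arrows `(1, c, 0, 1) : (Spec L, 0) → (Spec L, 0)` and
  -- `(1, id, [v], 1) : (Spec L, 0) → (Spec L, [v])`, and the composition bookkeeping
  have relI : ∀ c : X ⟶ X,
      (1 : Algebra.GrothendieckGroup ((arithDivisorFunctor F₀ K).obj (op X))) ^ ((1 : ℕ+) : ℕ) *
          Algebra.GrothendieckGroup.of (1 : (arithDivisorFunctor F₀ K).obj (op X)) =
        pullGp (arithDivisorFunctor F₀ K) c 1 *
          divB (arithDivisorFunctor F₀ K) (unitsFunctor F₀ K) (divNatTrans F₀ K) (op X) 1 := by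
    intro c
    rw [one_pow, map_one, map_one, map_one]
  have relφ :
      (1 : Algebra.GrothendieckGroup ((arithDivisorFunctor F₀ K).obj (op X))) ^ ((1 : ℕ+) : ℕ) *
          Algebra.GrothendieckGroup.of x =
        pullGp (arithDivisorFunctor F₀ K) (𝟙 X) (Algebra.GrothendieckGroup.of x) *
          divB (arithDivisorFunctor F₀ K) (unitsFunctor F₀ K) (divNatTrans F₀ K) (op X) 1 := by
    rw [one_pow, one_mul, map_one, mul_one, pullGp_id]
  have hΦ : ∀ c : X ⟶ X, ((arithDivisorFunctor F₀ K).map c.op).hom 1 *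
      (1 : (arithDivisorFunctor F₀ K).obj (op X)) ^ ((1 : ℕ+) : ℕ) = 1 := by
    intro c
    rw [map_one, one_pow, mul_one]
  have hB : ∀ c : X ⟶ X, ((unitsFunctor F₀ K).map c.op).hom 1 *
      (1 : (unitsFunctor F₀ K).obj (op X)) ^ ((1 : ℕ+) : ℕ) = 1 := by
    intro c
    rw [map_one, one_pow, mul_one]
  -- the objects `(Spec L, 0)`, `(Spec L, [v])`, the automorphism `β = (1, ρ, 0, 1)`, the morphism `φ`
  let Xc : arithFrobenioid F₀ K := ⟨X, 1⟩
  let Yc : arithFrobenioid F₀ K := ⟨X, Algebra.GrothendieckGroup.of x⟩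
  let βh : Xc ⟶ Xc := { degFr := 1, base := b.hom, div := 1, unit := 1, rel := relI b.hom }
  let βi : Xc ⟶ Xc := { degFr := 1, base := b.inv, div := 1, unit := 1, rel := relI b.inv }
  let β : Xc ≅ Xc :=
    { hom := βh
      inv := βi
      hom_inv_id := ModelFrobenioid.hom_ext rfl b.hom_inv_id (hΦ b.hom) (hB b.hom)
      inv_hom_id := ModelFrobenioid.hom_ext rfl b.inv_hom_id (hΦ b.inv) (hB b.inv) }
  let φ : Xc ⟶ Yc := { degFr := 1, base := 𝟙 X, div := x, unit := 1, rel := relφ }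
  -- (H) at `β`, `φ` says `ρ^* [v] = [v]`; compare the coefficients at `v`
  have h := congrArg (fun y : (arithDivisorFunctor F₀ K).obj (op X) =>
    (Multiplicative.toAdd y).1 (NumberField.FinitePlace.mk v)) (hH β φ)
  change (EffArithDivisor.pullback ((ρ : X.L ≃+* X.L) : X.L →+* X.L)
      (Finsupp.single (NumberField.FinitePlace.mk v) 1, 0)).1 (NumberField.FinitePlace.mk v) =
    (Finsupp.single (NumberField.FinitePlace.mk v) 1 : NumberField.FinitePlace X.L →₀ ℕ)
      (NumberField.FinitePlace.mk v) at h
  rw [EffArithDivisor.pullback_fst, Finsupp.single_eq_same] at h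
  dsimp only at h
  rw [Finsupp.single_eq_of_ne hne, mul_zero] at h
  exact zero_ne_one h

end ArithNeg

end PreFrobenioid

end

end Literature.AlgebraicGeometry.Frobenioids
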